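/-
Origin: expansion seat `planner-pub-hodgecm-qw8-g11-0`, handover #7 REPLACE (DOC-ONLY) md5 6b686107c32256352646631d4eb6d6a8 (78 l.) SUPERSEDES tree `HodgeCM/Model/Toy/LefModelAxioms.lean` ed6a8495 (71 l.): docstrings added to every undocumented theorem/def (CONVENTIONS §3 debt → 0), comment-stripped code IDENTICAL to the tree copy (residue md5 437de347; no declaration, statement or proof changed); imports unchanged (Mathlib, HodgeCM.Model.Toy.LefDescent; NO rew (`HOME/pub-hodgecm-qw8-g11/lean/Qw8g11/LefModelAxioms.lean`, md5 6b686107, 78 lines);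
landed by the packager successor (mc-unitary-1-g3, gen-8 kit) in gate run 32 REPLACES the earlier landed copy of `HodgeCM/Model/Toy/LefModelAxioms.lean` (seat copy carried the packager origin header of the earlier run (stripped)).
-/
-- HANDOVER (planner-pub-hodgecm-qw8-g6-0, unit pub-hodgecm-qw8-g6): WIP module `Qw8g6.LefModelAxioms`; intended final module
-- `HodgeCM.Model.Toy.LefModelAxioms` (kind L5, separating model); rename `import Qw8g6.X` ↦ `import HodgeCM.Model.Toy.X`.
/-
Copyright: pub-hodgecm cell (HodgeCMPerL). Separating-model layer (gens 5–6 of the [QW8] §2.5 lineage). New file.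

# `ModelAxioms lefModel` and every generic binder of `Assembly.COR_CM_of_descentFactsB`

All 28 model facts hold in the Lefschetz model (`lefModel_modelAxioms`: 22 verbatim from the exterior CM-model, M7–M10,
M11, M17, M26, M28 through the closure properties of `Bal` of `HodgeCM.Model.Toy.LefModel` and the generic transfer
`Universe.ModelAxioms.balMod`), and so do N1–N4, F4 `Fact_cupAlg`, F5, F-H0 `Fact_unitH0`, F7d-B `Fact_gysinDescentB`
(`HodgeCM.Model.Toy.LefDescent`) and `Fact_dimProd` (`lefModel_descentFactsB`).
-/
import Mathlib
import Summits.HodgeConjecture.HodgeCM.Model.Toy.LefDescent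

/-! PORT of `HodgeCM/Model/Toy/LefModelAxioms.lean` (HodgeCMPerL run 82) — verbatim mechanical port; provenance in the PORT header line. -/

noncomputable section

set_option backward.isDefEq.respectTransparency false

namespace HodgeCM.Toy

open scoped TensorProduct
open exteriorPower Module
open Literature.AlgebraicGeometry.Motives
open Literature.AlgebraicGeometry.Motives.HodgeStructure (ofRat ofRat_apply mem_hodgeClasses_iff)

/-- **`ModelAxioms lefModel`.** -/
theorem lefModel_modelAxioms : lefModel.ModelAxioms :=
  Universe.ModelAxioms.balMod GysinWitness.tM bal_pull bal_cup bal_lefschetz11 lef_cmDominated lef_gysin_surface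
    lef_algDuality

/-! ### The generic descent facts -/

/-- `Fact_cupExterior` holds in `lefModel` (transferred from the exterior CM-model). -/
theorem lef_cupExterior : lefModel.Fact_cupExterior :=
  (EM.balMod_fact_cupExterior_iff balB C7).mpr (fact_cupExterior exteriorHodgeData)

/-- `Fact_cup_hodge` holds in `lefModel` (transferred from the exterior CM-model). -/
theorem lef_cup_hodge : lefModel.Fact_cup_hodge := (EM.balMod_fact_cup_hodge_iff balB C7).mpr fact_cup_hodge

/-- `Fact_pull_H0` holds in `lefModel` (transferred from the exterior CM-model). -/
theorem lef_pull_H0 : lefModel.Fact_pull_H0 := (EM.balMod_fact_pull_H0_iff balB C7).mpr (fact_pull_H0 exteriorHodgeData)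

/-- `Fact_hodge_F0` holds in `lefModel` (transferred from the exterior CM-model). -/
theorem lef_hodge_F0 : lefModel.Fact_hodge_F0 := (EM.balMod_fact_hodge_F0_iff balB C7).mpr fact_hodge_F0

/-- `Fact_cupAssoc` holds in `lefModel` (transferred from the exterior CM-model). -/
theorem lef_cupAssoc : lefModel.Fact_cupAssoc :=
  (EM.balMod_fact_cupAssoc_iff balB C7).mpr (fact_cupAssoc exteriorHodgeData)

/-- `Fact_unitH0` holds in `lefModel` (transferred from the exterior CM-model). -/
theorem lef_unitH0 : lefModel.Fact_unitH0 := (EM.balMod_fact_unitH0_iff balB C7).mpr (fact_unitH0 exteriorHodgeData)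

/-- `Fact_dimProd` holds in `lefModel` (transferred from the exterior CM-model). -/
theorem lef_dimProd : lefModel.Fact_dimProd :=
  (EM.balMod_fact_dimProd_iff balB C7).mpr (GysinWitness.fact_dimProd exteriorHodgeData)

/-- **F4 for `lefModel`**: `Hdg ∩ Bal` is closed under cup product. -/
theorem lef_cupAlg : lefModel.Fact_cupAlg := Universe.Fact_cupAlg.balMod fact_cupAlg bal_cupAlg

/-- **F7d-B for `lefModel`**: Hodge descent (`fact_gysinDescentB`) and balanced descent (`bal_descentB`). -/
theorem lef_gysinDescentB : lefModel.Fact_gysinDescentB := Universe.Fact_gysinDescentB.balMod fact_gysinDescentB bal_descentB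

/-- **Every generic binder of `Assembly.COR_CM_of_descentFactsB` holds in `lefModel`.** -/
theorem lefModel_descentFactsB :
    lefModel.ModelAxioms ∧ lefModel.Fact_cupExterior ∧ lefModel.Fact_cup_hodge ∧ lefModel.Fact_pull_H0 ∧
      lefModel.Fact_hodge_F0 ∧ lefModel.Fact_cupAlg ∧ lefModel.Fact_cupAssoc ∧ lefModel.Fact_unitH0 ∧
      lefModel.Fact_gysinDescentB ∧ lefModel.Fact_dimProd :=
  ⟨lefModel_modelAxioms, lef_cupExterior, lef_cup_hodge, lef_pull_H0, lef_hodge_F0, lef_cupAlg, lef_cupAssoc,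
    lef_unitH0, lef_gysinDescentB, lef_dimProd⟩

end HodgeCM.Toy

end
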